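import Summits.ValiantsHypothesis.ValiantsHypothesis.Theorems.LacunarySymmetroidMatrixDescartesCensusDoorA34DefiniteEndLetterTwoCalculus
import Summits.ValiantsHypothesis.ValiantsHypothesis.Theorems.LacunarySymmetroidMatrixDescartesCensusDoorA34NineInertiaChamberIIUniqueDefinite
import Summits.ValiantsHypothesis.ValiantsHypothesis.Theorems.LacunarySymmetroidMatrixDescartesCensusWindowFourInterlacing

/-!
# `MatrixDescartes` census — DOOR A at `(3,4)`, flag ladder one size down: the `(2,3)` DEFINITE-END-LETTER LAW, part 2 (the law) —
# a real symmetric `2 × 2` pencil `S₀ + x^{d₁}S₁ + x^{d₂}S₂` with `S₀ ≻ 0` and `d₂ > 2d₁` has at most FOUR positive-semidefinite singular points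

HONEST FRAMING.  Object-search cell `pub-symmetroid`, door-A seat `val-sym-door-p3` (g24); helper file `--supports` the OPEN typed statement
`Theses.LacunarySymmetroid.DoorA34 = PosRootLawAt 3 4 18` (stmt-ValiantsHypothesis-19980), asserted nowhere here.  Companion of
`…DefiniteEndLetterTwoCalculus` (the defect `ρ` has at most four positive zeros).  Here the matrix side:

* `defect_eq_zero_of_psdSingular` — for `F(x) = 1 + x^aS₁ + x^{a+n}S₂` positive semidefinite and singular at `x > 0`: `x^a·λ_max(G) = 1` with
  `G = −(S₁ + xⁿS₂)`, i.e. `tr G + √((tr G)² − 4 det G) = 2/x^a` (from `det F = 0`: `x^{2a}·disc = (tr F)²`, and `tr F ≥ 0`);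
* `defect_five_zeros_false_of_sq` — the decoupled case (the discriminant a perfect square `(r(xⁿ − s₀))²`, i.e. parallel traceless parts): every
  zero of the defect is a positive root of one of two trinomials, at most `2 + 2`;
* **`no_five_psdSingular`** (bottom letter `1`) and **`no_five_psdSingular_of_posDef`** (any `S₀ ≻ 0`, congruence `S₀ = YᵀY` via
  `NineInertia.exists_transpose_mul_self_of_posDef`), **`card_psdSingular_le_four`** — THE `(2,3)` DEFINITE-END-LETTER LAW: with `d₀ = 0 < d₁`,
  `2d₁ < d₂`, `S₀ ≻ 0`, `S₁, S₂` real symmetric `2 × 2`, at most FOUR `x > 0` have `F(x)` positive semidefinite and singular — one below the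
  Descartes bound `5` of the format; the `λ_min`-walk `010101` (a pure-λ_min FIVE from a definite bottom letter) is impossible when `d₂ > 2d₁`.
  (Located sharpness, seat report DOOR-A34-P3G7 §2: for `d₂ < 2d₁` definite-bottom λ_min-fives exist; the census of record shows the side rule
  41/41.  The `m = 3` analogue on `d₂ < 2d₁` — Claim L, chambers III/IV — is the open source question of the flag ladder.)

Nothing here bounds `ζ_sym(3,3)` or `ζ_sym(3,4)`; `DoorA34`, Claim L on `d₂ < 2d₁` and `MatrixDescartes` (stmt-ValiantsHypothesis-18050) stay OPEN;
nothing on `VP ≠ VNP`.  [folklore] `2 × 2` eigenvalues by the quadratic formula, congruence; the argument is the seat lineage's (DOOR-A34-P3G7 §2b).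
-/

set_option linter.dupNamespace false

namespace Summit.ValiantsHypothesis.ValiantsHypothesis.Theorems.LacunarySymmetroidMatrixDescartes.Census

namespace EndLetterTwo

open Polynomial Finset Set
open scoped BigOperators Polynomial Matrix

/-! ## 4. Two-by-two pencils with bottom letter `1`: a PSD-singular point is a zero of the defect -/

/-- **A PSD-singular point is a zero of the top-branch defect.**  For `F(x) = 1 + x^a S₁ + x^{a+n} S₂` (`S₁, S₂` real symmetric `2 × 2`),
write `G = −(S₁ + xⁿ S₂)`, `T = tr G`, `Q = (G₀₀ − G₁₁)² + 4G₀₁² = T² − 4 det G`; if `F(x)` is positive semidefinite and singular (`x > 0`) then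
`x^a·λ_max(G) = 1`, i.e. `T + √Q = 2/x^a`. (From `det F = 0`: `x^{2a} Q = (2 − x^a T)²`, and `2 − x^a T = tr F ≥ 0`.) [folklore] -/
theorem defect_eq_zero_of_psdSingular (S₁ S₂ : Matrix (Fin 2) (Fin 2) ℝ) (h₁ : S₁ 1 0 = S₁ 0 1) (h₂ : S₂ 1 0 = S₂ 0 1)
    (a n : ℕ) {x : ℝ} (hx : 0 < x)
    (hpsd : ((1 : Matrix (Fin 2) (Fin 2) ℝ) + x ^ a • S₁ + x ^ (a + n) • S₂).PosSemidef)
    (hdet : ((1 : Matrix (Fin 2) (Fin 2) ℝ) + x ^ a • S₁ + x ^ (a + n) • S₂).det = 0) :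
    (-(S₁ 0 0 + S₁ 1 1)) + (-(S₂ 0 0 + S₂ 1 1)) * x ^ n
      + Real.sqrt (((S₂ 0 0 - S₂ 1 1) ^ 2 + 4 * S₂ 0 1 ^ 2) * x ^ (2 * n)
          + (2 * ((S₁ 0 0 - S₁ 1 1) * (S₂ 0 0 - S₂ 1 1) + 4 * (S₁ 0 1 * S₂ 0 1))) * x ^ n
          + ((S₁ 0 0 - S₁ 1 1) ^ 2 + 4 * S₁ 0 1 ^ 2))
      - 2 * (x ^ a)⁻¹ = 0 := by
  set c : ℝ := x ^ a with hc
  have hcpos : 0 < c := pow_pos hx a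
  -- entries of F(x)
  have e00 : ((1 : Matrix (Fin 2) (Fin 2) ℝ) + x ^ a • S₁ + x ^ (a + n) • S₂) 0 0 = 1 + c * S₁ 0 0 + c * x ^ n * S₂ 0 0 := by
    simp [Matrix.add_apply, Matrix.smul_apply, pow_add, hc]
  have e11 : ((1 : Matrix (Fin 2) (Fin 2) ℝ) + x ^ a • S₁ + x ^ (a + n) • S₂) 1 1 = 1 + c * S₁ 1 1 + c * x ^ n * S₂ 1 1 := by
    simp [Matrix.add_apply, Matrix.smul_apply, pow_add, hc]
  have e01 : ((1 : Matrix (Fin 2) (Fin 2) ℝ) + x ^ a • S₁ + x ^ (a + n) • S₂) 0 1 = c * S₁ 0 1 + c * x ^ n * S₂ 0 1 := by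
    simp [Matrix.add_apply, Matrix.smul_apply, pow_add, hc]
  have e10 : ((1 : Matrix (Fin 2) (Fin 2) ℝ) + x ^ a • S₁ + x ^ (a + n) • S₂) 1 0 = c * S₁ 0 1 + c * x ^ n * S₂ 0 1 := by
    simp [Matrix.add_apply, Matrix.smul_apply, pow_add, hc, h₁, h₂]
  -- trace ≥ 0 and det = 0
  have hd0 := hpsd.diag_nonneg (i := 0)
  have hd1 := hpsd.diag_nonneg (i := 1)
  rw [e00] at hd0
  rw [e11] at hd1
  rw [Matrix.det_fin_two, e00, e11, e01, e10] at hdet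
  -- abbreviations: T = tr G, Q = disc
  set T : ℝ := (-(S₁ 0 0 + S₁ 1 1)) + (-(S₂ 0 0 + S₂ 1 1)) * x ^ n with hT
  set Q : ℝ := ((S₂ 0 0 - S₂ 1 1) ^ 2 + 4 * S₂ 0 1 ^ 2) * x ^ (2 * n)
          + (2 * ((S₁ 0 0 - S₁ 1 1) * (S₂ 0 0 - S₂ 1 1) + 4 * (S₁ 0 1 * S₂ 0 1))) * x ^ n
          + ((S₁ 0 0 - S₁ 1 1) ^ 2 + 4 * S₁ 0 1 ^ 2) with hQ
  have hQsos : Q = ((S₁ 0 0 - S₁ 1 1) + (S₂ 0 0 - S₂ 1 1) * x ^ n) ^ 2 + 4 * (S₁ 0 1 + S₂ 0 1 * x ^ n) ^ 2 := by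
    rw [hQ]; ring
  have hQnn : 0 ≤ Q := by rw [hQsos]; positivity
  have hu : 0 ≤ 2 - c * T := by rw [hT]; nlinarith
  -- c² Q = (2 − cT)²
  have hkey : Q = ((2 - c * T) / c) ^ 2 := by
    rw [div_pow, eq_div_iff (pow_ne_zero _ hcpos.ne'), hQsos, hT]
    linear_combination (-4 : ℝ) * hdet
  have hsqrt : Real.sqrt Q = (2 - c * T) / c :=
    (Real.sqrt_eq_iff_eq_sq hQnn (div_nonneg hu hcpos.le)).mpr hkey
  rw [hsqrt]
  field_simp
  ring

/-! ## 5. The degenerate (decoupled) case: `Q` a perfect square vanishing at a positive point -/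

/-- **Decoupled case.**  If `Q(x) = (r(xⁿ − s₀))²` identically (`r ≥ 0`), then `√Q = r|xⁿ − s₀|` and every zero of the defect
`T₀ + T₁xⁿ + √Q − 2/xᵃ` is a positive root of one of the two trinomials `−2 + (T₀ ∓ r s₀)Xᵃ + (T₁ ± r)X^{a+n}`; so there are at most
`2 + 2 = 4` of them (`Census.card_posRoots_trinomial_le_two`). [folklore] -/
theorem defect_five_zeros_false_of_sq (A B C₀ T₀ T₁ r s₀ : ℝ) {a n : ℕ} (ha : 0 < a)
    (hQ : ∀ x : ℝ, A * x ^ (2 * n) + B * x ^ n + C₀ = (r * (x ^ n - s₀)) ^ 2)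
    {x : Fin 5 → ℝ} (hx0 : 0 < x 0) (hx : StrictMono x)
    (hroot : ∀ i, T₀ + T₁ * x i ^ n + Real.sqrt (A * x i ^ (2 * n) + B * x i ^ n + C₀) - 2 * (x i ^ a)⁻¹ = 0) : False := by
  have hxpos : ∀ i, 0 < x i := fun i => lt_of_lt_of_le hx0 (hx.monotone (Fin.zero_le i))
  have hne : ∀ (u v : ℝ), (C (-2) * X ^ 0 + C u * X ^ a + C v * X ^ (a + n) : ℝ[X]) ≠ 0 := by
    intro u v h0
    have hc := congrArg (fun P : ℝ[X] => P.coeff 0) h0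
    have h1 : (0 : ℕ) ≠ a := by omega
    have h2 : (0 : ℕ) ≠ a + n := by omega
    simp [coeff_X_pow, h1, h2] at hc
  have hmem : ∀ i, x i ∈ (C (-2) * X ^ 0 + C (T₀ - r * s₀) * X ^ a + C (T₁ + r) * X ^ (a + n) : ℝ[X]).roots.toFinset.filter
        (fun t => 0 < t) ∪ (C (-2) * X ^ 0 + C (T₀ + r * s₀) * X ^ a + C (T₁ - r) * X ^ (a + n) : ℝ[X]).roots.toFinset.filter
        (fun t => 0 < t) := by
    intro i
    have h := hroot i
    rw [hQ, Real.sqrt_sq_eq_abs] at h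
    have hxa : x i ^ a ≠ 0 := pow_ne_zero _ (hxpos i).ne'
    rw [Finset.mem_union]
    rcases le_or_gt 0 (r * (x i ^ n - s₀)) with hcase | hcase
    · left
      rw [abs_of_nonneg hcase] at h
      simp only [Finset.mem_filter, Multiset.mem_toFinset, mem_roots (hne _ _), IsRoot.def, eval_add, eval_mul, eval_C,
        eval_pow, eval_X]
      refine ⟨?_, hxpos i⟩
      field_simp at h
      rw [pow_add]
      linear_combination h
    · right
      rw [abs_of_neg hcase] at h
      simp only [Finset.mem_filter, Multiset.mem_toFinset, mem_roots (hne _ _), IsRoot.def, eval_add, eval_mul, eval_C,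
        eval_pow, eval_X]
      refine ⟨?_, hxpos i⟩
      field_simp at h
      rw [pow_add]
      linear_combination h
  have hsub : Finset.univ.image x ⊆ (C (-2) * X ^ 0 + C (T₀ - r * s₀) * X ^ a + C (T₁ + r) * X ^ (a + n) : ℝ[X]).roots.toFinset.filter
        (fun t => 0 < t) ∪ (C (-2) * X ^ 0 + C (T₀ + r * s₀) * X ^ a + C (T₁ - r) * X ^ (a + n) : ℝ[X]).roots.toFinset.filter
        (fun t => 0 < t) := by
    intro t ht
    obtain ⟨i, -, rfl⟩ := Finset.mem_image.mp ht
    exact hmem i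
  have hcard : (Finset.univ.image x).card = 5 := by
    rw [Finset.card_image_of_injective _ hx.injective, Finset.card_univ, Fintype.card_fin]
  have h5 := Finset.card_le_card hsub
  rw [hcard] at h5
  have hp := Census.card_posRoots_trinomial_le_two 0 a (a + n) (-2) (T₀ - r * s₀) (T₁ + r) (hne _ _)
  have hm := Census.card_posRoots_trinomial_le_two 0 a (a + n) (-2) (T₀ + r * s₀) (T₁ - r) (hne _ _)
  have hu := Finset.card_union_le
    ((C (-2) * X ^ 0 + C (T₀ - r * s₀) * X ^ a + C (T₁ + r) * X ^ (a + n) : ℝ[X]).roots.toFinset.filter (fun t => 0 < t))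
    ((C (-2) * X ^ 0 + C (T₀ + r * s₀) * X ^ a + C (T₁ - r) * X ^ (a + n) : ℝ[X]).roots.toFinset.filter (fun t => 0 < t))
  omega

/-! ## 6. THE (2,3) DEFINITE-END-LETTER LAW -/

/-- The three-letter `2 × 2` pencil with bottom letter `1` written out: `∑ x^{d l} S_l = 1 + x^{d₁} S₁ + x^{d₂} S₂`. [folklore] -/
theorem pencil_eq_two (d : Fin 3 → ℕ) (S : Fin 3 → Matrix (Fin 2) (Fin 2) ℝ) (h0 : d 0 = 0) (hS0 : S 0 = 1) (x : ℝ) :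
    (∑ l, x ^ d l • S l) = (1 : Matrix (Fin 2) (Fin 2) ℝ) + x ^ d 1 • S 1 + x ^ d 2 • S 2 := by
  rw [Fin.sum_univ_three, h0, hS0, pow_zero, one_smul]

/-- **THE (2,3) DEFINITE-END-LETTER LAW (bottom letter `1`).**  Let `F(x) = 1 + x^{d₁}S₁ + x^{d₂}S₂` be a real symmetric `2 × 2`
three-letter pencil with `0 < d₁` and `2d₁ < d₂`.  Then `F` is positive semidefinite and singular at NO five points
`0 < x₀ < x₁ < x₂ < x₃ < x₄`: the top eigenvalue branch is crossed at most FOUR times — one below the Descartes bound `5 = D(2,3)` of the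
format.  (Sharp side: for `d₂ < 2d₁` five PSD-singular points occur, seat report DOOR-A34-P3G7 §2; not formalised.)  PROOF: a PSD-singular
point is a zero of the defect `ρ` (`defect_eq_zero_of_psdSingular`); if the discriminant `Q` is positive on `(0,∞)` use
`rho_five_zeros_false` (Rolle twice + Descartes), otherwise `Q` is a perfect square (the letters' traceless parts are parallel) and
`defect_five_zeros_false_of_sq` applies. [folklore] -/
theorem no_five_psdSingular (d : Fin 3 → ℕ) (S : Fin 3 → Matrix (Fin 2) (Fin 2) ℝ) (hS : ∀ l, (S l).IsSymm)
    (h0 : d 0 = 0) (hS0 : S 0 = 1) (hd1 : 0 < d 1) (hd : 2 * d 1 < d 2)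
    {x : Fin 5 → ℝ} (hx0 : 0 < x 0) (hx : StrictMono x)
    (hpsd : ∀ i, (∑ l, x i ^ d l • S l).PosSemidef) (hdet : ∀ i, (∑ l, x i ^ d l • S l).det = 0) : False := by
  obtain ⟨n, hn, hd2⟩ : ∃ n, d 1 < n ∧ d 2 = d 1 + n := ⟨d 2 - d 1, by omega, by omega⟩
  have hxpos : ∀ i, 0 < x i := fun i => lt_of_lt_of_le hx0 (hx.monotone (Fin.zero_le i))
  have h₁ : S 1 1 0 = S 1 0 1 := (hS 1).apply 0 1
  have h₂ : S 2 1 0 = S 2 0 1 := (hS 2).apply 0 1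
  -- every PSD-singular point is a zero of the defect
  have hroot : ∀ i, (-(S 1 0 0 + S 1 1 1)) + (-(S 2 0 0 + S 2 1 1)) * x i ^ n
      + Real.sqrt (((S 2 0 0 - S 2 1 1) ^ 2 + 4 * S 2 0 1 ^ 2) * x i ^ (2 * n)
          + (2 * ((S 1 0 0 - S 1 1 1) * (S 2 0 0 - S 2 1 1) + 4 * (S 1 0 1 * S 2 0 1))) * x i ^ n
          + ((S 1 0 0 - S 1 1 1) ^ 2 + 4 * S 1 0 1 ^ 2))
      - 2 * (x i ^ d 1)⁻¹ = 0 := by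
    intro i
    have hp := hpsd i
    have hdt := hdet i
    rw [pencil_eq_two d S h0 hS0, hd2] at hp hdt
    exact defect_eq_zero_of_psdSingular (S 1) (S 2) h₁ h₂ (d 1) n (hxpos i) hp hdt
  have hA : 0 ≤ (S 2 0 0 - S 2 1 1) ^ 2 + 4 * S 2 0 1 ^ 2 := by positivity
  have hC : 0 ≤ (S 1 0 0 - S 1 1 1) ^ 2 + 4 * S 1 0 1 ^ 2 := by positivity
  have hΔ : (2 * ((S 1 0 0 - S 1 1 1) * (S 2 0 0 - S 2 1 1) + 4 * (S 1 0 1 * S 2 0 1))) ^ 2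
      ≤ 4 * ((S 2 0 0 - S 2 1 1) ^ 2 + 4 * S 2 0 1 ^ 2) * ((S 1 0 0 - S 1 1 1) ^ 2 + 4 * S 1 0 1 ^ 2) := by
    nlinarith [sq_nonneg ((S 1 0 0 - S 1 1 1) * S 2 0 1 - S 1 0 1 * (S 2 0 0 - S 2 1 1))]
  by_cases hQ : ∀ t : ℝ, 0 < t → 0 < ((S 2 0 0 - S 2 1 1) ^ 2 + 4 * S 2 0 1 ^ 2) * t ^ (2 * n)
      + (2 * ((S 1 0 0 - S 1 1 1) * (S 2 0 0 - S 2 1 1) + 4 * (S 1 0 1 * S 2 0 1))) * t ^ n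
      + ((S 1 0 0 - S 1 1 1) ^ 2 + 4 * S 1 0 1 ^ 2)
  · exact rho_five_zeros_false _ _ _ _ _ hd1 hn hA hC hΔ hQ hx0 hx hroot
  · push Not at hQ
    obtain ⟨t, ht, hQt⟩ := hQ
    -- the discriminant is a sum of two squares; both vanish at `t`
    have hsos : ∀ y : ℝ, ((S 2 0 0 - S 2 1 1) ^ 2 + 4 * S 2 0 1 ^ 2) * y ^ (2 * n)
        + (2 * ((S 1 0 0 - S 1 1 1) * (S 2 0 0 - S 2 1 1) + 4 * (S 1 0 1 * S 2 0 1))) * y ^ n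
        + ((S 1 0 0 - S 1 1 1) ^ 2 + 4 * S 1 0 1 ^ 2)
        = ((S 1 0 0 - S 1 1 1) + (S 2 0 0 - S 2 1 1) * y ^ n) ^ 2 + 4 * (S 1 0 1 + S 2 0 1 * y ^ n) ^ 2 := by
      intro y; ring
    rw [hsos] at hQt
    have hα : (S 1 0 0 - S 1 1 1) + (S 2 0 0 - S 2 1 1) * t ^ n = 0 := by nlinarith [sq_nonneg (S 1 0 1 + S 2 0 1 * t ^ n)]
    have hγ : S 1 0 1 + S 2 0 1 * t ^ n = 0 := by
      nlinarith [sq_nonneg ((S 1 0 0 - S 1 1 1) + (S 2 0 0 - S 2 1 1) * t ^ n)]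
    refine defect_five_zeros_false_of_sq _ _ _ _ _ (Real.sqrt ((S 2 0 0 - S 2 1 1) ^ 2 + 4 * S 2 0 1 ^ 2)) (t ^ n) hd1
      (fun y => ?_) hx0 hx hroot
    rw [hsos, mul_pow, Real.sq_sqrt hA]
    have e1 : S 1 0 0 - S 1 1 1 = -((S 2 0 0 - S 2 1 1) * t ^ n) := by linarith
    have e2 : S 1 0 1 = -(S 2 0 1 * t ^ n) := by linarith
    rw [e1, e2]
    ring

/-- Evaluation form of a congruence of the three-letter `2 × 2` pencil: `∑ x^{d l} • (P S_l Q) = P (∑ x^{d l} • S_l) Q`. [folklore] -/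
theorem eval_pencil_congr_two (d : Fin 3 → ℕ) (S : Fin 3 → Matrix (Fin 2) (Fin 2) ℝ) (P Q : Matrix (Fin 2) (Fin 2) ℝ) (x : ℝ) :
    (∑ l, x ^ d l • (P * S l * Q)) = P * (∑ l, x ^ d l • S l) * Q := by
  rw [Finset.mul_sum, Finset.sum_mul]
  refine Finset.sum_congr rfl fun l _ => ?_
  rw [Matrix.mul_smul, Matrix.smul_mul]

/-- **THE (2,3) DEFINITE-END-LETTER LAW (any positive definite bottom letter).**  Let `F(x) = S₀ + x^{d₁}S₁ + x^{d₂}S₂` be a real symmetric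
`2 × 2` three-letter pencil with `S₀ ≻ 0`, `d₀ = 0 < d₁` and `2d₁ < d₂`.  Then there are no five points `0 < x₀ < ⋯ < x₄` at which `F` is
positive semidefinite and singular: the `λ_min`-branch of a definite-bottom `(2,3)` row carries at most FOUR roots when `d₂ > 2d₁` — the
`m = 2` case of the flag ladder's «no pure-λ_min row from a definite end» (seat report DOOR-A34-P3G7 §2b; congruence `S₀ = YᵀY` +
`no_five_psdSingular`). [folklore] -/
theorem no_five_psdSingular_of_posDef (d : Fin 3 → ℕ) (S : Fin 3 → Matrix (Fin 2) (Fin 2) ℝ) (hS : ∀ l, (S l).IsSymm)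
    (hP0 : (S 0).PosDef) (h0 : d 0 = 0) (hd1 : 0 < d 1) (hd : 2 * d 1 < d 2)
    {x : Fin 5 → ℝ} (hx0 : 0 < x 0) (hx : StrictMono x)
    (hpsd : ∀ i, (∑ l, x i ^ d l • S l).PosSemidef) (hdet : ∀ i, (∑ l, x i ^ d l • S l).det = 0) : False := by
  obtain ⟨Y, hYdet, hY⟩ := NineInertia.exists_transpose_mul_self_of_posDef hP0
  have hYu : IsUnit Y.det := isUnit_iff_ne_zero.mpr hYdet
  set Z : Matrix (Fin 2) (Fin 2) ℝ := Y⁻¹ with hZ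
  have hYZ : Y * Z = 1 := Matrix.mul_nonsing_inv Y hYu
  set S' : Fin 3 → Matrix (Fin 2) (Fin 2) ℝ := fun l => Zᵀ * S l * Z with hS'
  have hS'0 : S' 0 = 1 := by
    show Zᵀ * S 0 * Z = 1
    rw [hY, ← Matrix.mul_assoc, ← Matrix.transpose_mul, Matrix.mul_assoc, hYZ, Matrix.transpose_one, Matrix.one_mul]
  have hS'symm : ∀ l, (S' l).IsSymm := fun l => by
    show (Zᵀ * S l * Z).IsSymm
    unfold Matrix.IsSymm
    rw [Matrix.transpose_mul, Matrix.transpose_mul, Matrix.transpose_transpose, (hS l).eq, Matrix.mul_assoc]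
  have hcongr : ∀ t : ℝ, (∑ l, t ^ d l • S' l) = Zᵀ * (∑ l, t ^ d l • S l) * Z := fun t => eval_pencil_congr_two d S Zᵀ Z t
  refine no_five_psdSingular d S' hS'symm h0 hS'0 hd1 hd hx0 hx (fun i => ?_) (fun i => ?_)
  · rw [hcongr, ← Matrix.conjTranspose_eq_transpose_of_trivial]
    exact (hpsd i).conjTranspose_mul_mul_same Z
  · rw [hcongr, Matrix.det_mul, Matrix.det_mul, hdet i, mul_zero, zero_mul]

/-- **Card form.**  Under the hypotheses of `no_five_psdSingular_of_posDef`, every finite set of positive PSD-singular points of `F` has at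
most four elements. [folklore] -/
theorem card_psdSingular_le_four (d : Fin 3 → ℕ) (S : Fin 3 → Matrix (Fin 2) (Fin 2) ℝ) (hS : ∀ l, (S l).IsSymm)
    (hP0 : (S 0).PosDef) (h0 : d 0 = 0) (hd1 : 0 < d 1) (hd : 2 * d 1 < d 2) (T : Finset ℝ)
    (hT : ∀ x ∈ T, 0 < x ∧ (∑ l, x ^ d l • S l).PosSemidef ∧ (∑ l, x ^ d l • S l).det = 0) : T.card ≤ 4 := by
  by_contra h5
  obtain ⟨T', hT'T, hcard⟩ := Finset.exists_subset_card_eq (show 5 ≤ T.card by omega)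
  set x : Fin 5 → ℝ := fun i => T'.orderEmbOfFin hcard i with hxdef
  have hxmem : ∀ i, x i ∈ T := fun i => hT'T (T'.orderEmbOfFin_mem hcard i)
  have hx : StrictMono x := fun i j hij => (T'.orderEmbOfFin hcard).strictMono hij
  exact no_five_psdSingular_of_posDef d S hS hP0 h0 hd1 hd (hT _ (hxmem 0)).1 hx (fun i => (hT _ (hxmem i)).2.1)
    (fun i => (hT _ (hxmem i)).2.2)

end EndLetterTwo

end Summit.ValiantsHypothesis.ValiantsHypothesis.Theorems.LacunarySymmetroidMatrixDescartes.Census
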